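import Mathlib
import Summits.Schanuel.Schanuel.Theorems.DiophantineDichotomyKhovanskiiApproxTypeEvLambertChallengerLevel
import HarnessLib

/-!
# Route `DiophantineDichotomy`, crux `KhovanskiiApproxTypeEv` (stmt-Schanuel-14972), line `lambert-liouville-kill`:
# stub `stub_anchoredLevel` — level `(D, H₂)` of the rank-3 challenger `(1, β, p/q, α, −1, q/(kp))`

Crux `Summit.Schanuel.Schanuel.Theses.DiophantineDichotomy.KhovanskiiApproxTypeEv` (item stmt-Schanuel-14972),
certificate line `lambert-liouville-kill` (skeleton `Cruxes/KhovanskiiApproxTypeEv/Lines/lambert_liouville_kill.lean`,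
lead `prover-line-stmt-Schanuel-14972-a1-0`), registered stub `stub_anchoredLevel` (landed `--supports stmt-Schanuel-14972`).

In the anchored (rank-3) certificate `notLiouville_lambert_of_evAnchored` the eventual crux is fed the
6-coordinate challenger `γ = (1, β, p/q, α, −1, q/(kp)) : Fin 3 ⊕ Fin 3 → ℂ`, built from an algebraic pair
`γ₂ = (β, α)` of level `(d₂, H₂)` (`[ℚ(γ₂):ℚ] ≤ d₂`, each `γ₂ i` a root of a non-zero `P ∈ ℤ[X]` of degree
`≤ d₂` and height `≤ H₂`) and a rational `p/q` with `1 ≤ p`, `k p ≤ q ≤ H₂`.  This stub certifies its LEVEL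
`(D, H₂)` for any `D ≥ max 1 d₂`:
* `[ℚ(γ):ℚ] ≤ D`: `ℚ(γ) ≤ ℚ(γ₂)` (the four other coordinates are rational, `IntermediateField.adjoin_le_iff`),
  `ℚ(γ₂)/ℚ` is finite (`IntermediateField.finiteDimensional_adjoin`, every `γ₂ i` being integral), so
  `[ℚ(γ):ℚ] ≤ [ℚ(γ₂):ℚ] ≤ d₂ ≤ D` (`IntermediateField.finrank_le_of_le_right`);
* each coordinate is a root of a non-zero integer polynomial of degree `≤ D` and height `≤ H₂`: the given
  certificates of `β`, `α`, the linear certificates `X − 1`, `q X − p`, `(k p) X − q` of the landed helper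
  `exists_linearCert` (`…LambertChallengerLevel`), and `X + 1` for `−1` (`exists_negOneCert`).
Pattern of the landed `stub_challengerLevel`.  Mathlib + the landed helper only.
-/

noncomputable section

-- `Summit.Schanuel.Schanuel.…` is the mandated summit/sub-problem namespace (single-conjunct summit), hence:
set_option linter.dupNamespace false

namespace Summit.Schanuel.Schanuel.Cruxes.KhovanskiiApproxTypeEv.LambertLiouvilleKill

open Polynomial

/-- The integer certificate `X + 1` of `−1`: for `1 ≤ H` and `1 ≤ d` the polynomial `X + C 1 ∈ ℤ[X]` is
non-zero, of degree `1 ≤ d`, of height `1 ≤ H`, and vanishes at `−1 ∈ ℂ`. [folklore] -/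
theorem exists_negOneCert (H d : ℕ) (hH : 1 ≤ H) (hd : 1 ≤ d) :
    ∃ Q : Polynomial ℤ, Q ≠ 0 ∧ Q.natDegree ≤ d ∧ (∀ j, |Q.coeff j| ≤ (H : ℤ)) ∧
      Polynomial.aeval (-1 : ℂ) Q = 0 := by
  have hH' : (1 : ℤ) ≤ H := by exact_mod_cast hH
  refine ⟨X + C 1, X_add_C_ne_zero 1, ?_, ?_, ?_⟩
  · rw [natDegree_X_add_C]; exact hd
  · intro j
    rw [coeff_add, coeff_X, coeff_C]
    split_ifs <;> simp <;> omega
  · simp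

/-- **STUB 9 (level of the anchored challenger).**  For an algebraic pair `γ₂ = (β, α) : Fin 2 → ℂ` of
level `(d₂, H₂)` — `[ℚ(γ₂):ℚ] ≤ d₂` and each `γ₂ i` a root of a non-zero `P ∈ ℤ[X]` of degree `≤ d₂` and
height `≤ H₂` — and naturals `1 ≤ k`, `1 ≤ p`, `k p ≤ q ≤ H₂`, `max 1 d₂ ≤ D`, the 6-vector
`γ = (1, β, p/q, α, −1, q/(kp)) : Fin 3 ⊕ Fin 3 → ℂ` has `[ℚ(γ):ℚ] ≤ D`, and each coordinate of `γ` is a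
root of a non-zero integer polynomial of degree `≤ D` and height `≤ H₂`.  Proof: `ℚ(γ) ≤ ℚ(γ₂)`
(`IntermediateField.adjoin_le_iff`; `1`, `p/q`, `−1`, `q/(kp)` lie in every intermediate field), `ℚ(γ₂)/ℚ`
finite (`IntermediateField.finiteDimensional_adjoin`), `IntermediateField.finrank_le_of_le_right`; the
certificates are the given ones for `β`, `α`, `exists_linearCert` for `1`, `p/q`, `q/(kp)` and
`exists_negOneCert` for `−1` (note `1 ≤ k p ≤ q ≤ H₂`). [folklore; pattern of `stub_challengerLevel`] -/
theorem stub_anchoredLevel :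
    ∀ (D k p q : ℕ) (γ₂ : Fin 2 → ℂ) (d₂ H₂ : ℕ), 1 ≤ k → 1 ≤ p → k * p ≤ q → q ≤ H₂ → d₂ ≤ D →
      1 ≤ D → Module.finrank ℚ ↥(IntermediateField.adjoin ℚ (Set.range γ₂)) ≤ d₂ →
      (∀ i, ∃ P : ℤ[X], P ≠ 0 ∧ P.natDegree ≤ d₂ ∧ (∀ j, |P.coeff j| ≤ (H₂ : ℤ)) ∧
        Polynomial.aeval (γ₂ i) P = 0) →
      Module.finrank ℚ ↥(IntermediateField.adjoin ℚ (Set.range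
          (Sum.elim ![(1 : ℂ), γ₂ 0, (p : ℂ) / q] ![γ₂ 1, -1, (q : ℂ) / (k * p)]))) ≤ D ∧
        ∀ i, ∃ Q : ℤ[X], Q ≠ 0 ∧ Q.natDegree ≤ D ∧ (∀ j, |Q.coeff j| ≤ (H₂ : ℤ)) ∧
          Polynomial.aeval (Sum.elim ![(1 : ℂ), γ₂ 0, (p : ℂ) / q] ![γ₂ 1, -1, (q : ℂ) / (k * p)] i) Q
            = 0 := by
  intro D k p q γ₂ d₂ H₂ hk hp hkpq hqH hd₂D hD1 hfr₂ hcert₂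
  -- elementary size bookkeeping: 1 ≤ p ≤ k p ≤ q ≤ H₂
  have hpkp : p ≤ k * p := Nat.le_mul_of_pos_left p (by omega)
  have hkp1 : 1 ≤ k * p := le_trans hp hpkp
  have hq1 : 1 ≤ q := le_trans hkp1 hkpq
  have hH1 : 1 ≤ H₂ := le_trans hq1 hqH
  have hpH : p ≤ H₂ := le_trans (le_trans hpkp hkpq) hqH
  have hkpH : k * p ≤ H₂ := le_trans hkpq hqH
  -- every `γ₂ i` is integral over `ℚ` (root of its non-zero certificate, mapped to `ℚ[X]`)
  have hint : ∀ i, IsIntegral ℚ (γ₂ i) := by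
    intro i
    obtain ⟨P, hP0, -, -, hPγ⟩ := hcert₂ i
    have hPQ0 : P.map (Int.castRingHom ℚ) ≠ 0 :=
      (Polynomial.map_ne_zero_iff (Int.castRingHom ℚ).injective_int).mpr hP0
    have hPQγ : Polynomial.aeval (γ₂ i) (P.map (Int.castRingHom ℚ)) = 0 := by
      rw [← algebraMap_int_eq, aeval_map_algebraMap]; exact hPγ
    exact (show IsAlgebraic ℚ (γ₂ i) from ⟨_, hPQ0, hPQγ⟩).isIntegral
  refine ⟨?_, ?_⟩
  · -- `ℚ(γ) ≤ ℚ(γ₂)`, the latter finite over `ℚ` of degree `≤ d₂ ≤ D`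
    have hle : IntermediateField.adjoin ℚ (Set.range
          (Sum.elim ![(1 : ℂ), γ₂ 0, (p : ℂ) / q] ![γ₂ 1, -1, (q : ℂ) / (k * p)])) ≤
        IntermediateField.adjoin ℚ (Set.range γ₂) := by
      rw [IntermediateField.adjoin_le_iff]
      rintro _ ⟨i, rfl⟩
      rcases i with i | i <;> fin_cases i
      · exact one_mem _
      · exact IntermediateField.subset_adjoin ℚ _ ⟨0, rfl⟩
      · exact div_mem (natCast_mem _ p) (natCast_mem _ q)
      · exact IntermediateField.subset_adjoin ℚ _ ⟨1, rfl⟩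
      · exact neg_mem (one_mem _)
      · exact div_mem (natCast_mem _ q) (mul_mem (natCast_mem _ k) (natCast_mem _ p))
    haveI : FiniteDimensional ℚ (IntermediateField.adjoin ℚ (Set.range γ₂)) :=
      IntermediateField.finiteDimensional_adjoin (by rintro _ ⟨i, rfl⟩; exact hint i)
    exact ((IntermediateField.finrank_le_of_le_right hle).trans hfr₂).trans hd₂D
  · -- the six certificates: `X − 1`, `P_β`, `q X − p`, `P_α`, `X + 1`, `(k p) X − q`
    rintro (i | i) <;> fin_cases i
    · exact exists_linearCert 1 1 H₂ D le_rfl hH1 hH1 hD1 1 (by norm_num)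
    · obtain ⟨P, hP0, hPdeg, hPcoef, hPγ⟩ := hcert₂ 0
      exact ⟨P, hP0, hPdeg.trans hd₂D, hPcoef, hPγ⟩
    · exact exists_linearCert q p H₂ D hq1 hqH hpH hD1 ((p : ℂ) / q)
        (by have hq0 : (q : ℂ) ≠ 0 := by exact_mod_cast (show q ≠ 0 by omega)
            field_simp)
    · obtain ⟨P, hP0, hPdeg, hPcoef, hPγ⟩ := hcert₂ 1
      exact ⟨P, hP0, hPdeg.trans hd₂D, hPcoef, hPγ⟩
    · exact exists_negOneCert H₂ D hH1 hD1
    · exact exists_linearCert (k * p) q H₂ D hkp1 hkpH hqH hD1 ((q : ℂ) / (k * p))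
        (by have hk0 : (k : ℂ) ≠ 0 := by exact_mod_cast (show k ≠ 0 by omega)
            have hp0 : (p : ℂ) ≠ 0 := by exact_mod_cast (show p ≠ 0 by omega)
            push_cast; field_simp)

end Summit.Schanuel.Schanuel.Cruxes.KhovanskiiApproxTypeEv.LambertLiouvilleKill

end
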